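import Literature.ModelTheory.Quasiminimal.ContinuumModel
import Literature.NumberTheory.Transcendental.GammaIsoTransfer
import HarnessLib

/-!
# Strongness of the base in the continuum model

Bays–Kirby 2018 axiom 3 (Thm 8.2 / Thm 9.1): the base `F_base` is *strong* in `F`, `δ(x̄/F_base)
≥ 0` for every finite tuple — in the tree's exponential-case form `GammaField.IsStrong Λ` for the
`ℚ`-span `Λ` of the base inside `F` (`GammaFields.lean`). We show that it passes from the
countable chart `M` to the continuum model `F = S.F` of `ContinuumModel.lean`: the predimension
`δ = td − ldim` is invariant under injective E-field embeddings (`GammaField.predim_map`, from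
`MatroidComap.relRank_image_ringHom` and the invariance of relative linear dimension under
injective linear maps), and every finitely generated extension of the base inside `F` lives in
one chart (`Setup.isStrong_F`). This is the easy half of "axioms 1–4 are preserved under
unions of directed systems of strong embeddings" (B–K, proof of Thm 8.2).

## References

* M. Bays, J. Kirby, *Pseudo-exponential maps, variants, and quasiminimality*, Algebra & Number
  Theory 12 (2018), Def. 4.1, Def. 4.3, Thm 8.2 (proof).
-/

noncomputable section

suppress_compilation

open Set
open Literature.ModelTheory.ExponentialFields

namespace Literature.NumberTheory.Transcendental.GammaField

section Map

variable {M N : Type*} [Field M] [CharZero M] [ExponentialRing M] [Field N] [CharZero N]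
  [ExponentialRing N]

/-- An E-ring morphism of characteristic-zero exponential fields as a `ℚ`-linear map.
[folklore] -/
def linearOf (j : ExponentialRingHom M N) : M →ₗ[ℚ] N :=
  (j.toRingHom.toRatAlgHom : M →ₐ[ℚ] N).toLinearMap

/-- Unfolding `linearOf`. [folklore] -/
@[simp] theorem linearOf_apply (j : ExponentialRingHom M N) (x : M) : linearOf j x = j x := rfl

/-- `linearOf j` is injective (field homomorphisms are). [folklore] -/
theorem linearOf_injective (j : ExponentialRingHom M N) : Function.Injective (linearOf j) :=
  j.toRingHom.injective

/-- The generators `Λ ∪ exp Λ` of the Γ-subfield commute with E-ring morphisms. [folklore] -/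
theorem gens_map (j : ExponentialRingHom M N) (Λ : Submodule ℚ M) :
    gens (Λ.map (linearOf j)) = j '' gens Λ := by
  ext y
  simp only [gens, Submodule.map_coe, mem_union, mem_image, SetLike.mem_coe, linearOf_apply,
    image_union]
  constructor
  · rintro (⟨x, hx, rfl⟩ | ⟨_, ⟨x, hx, rfl⟩, rfl⟩)
    · exact Or.inl ⟨x, hx, rfl⟩
    · exact Or.inr ⟨ExponentialRing.exp x, ⟨x, hx, rfl⟩, j.map_exp x⟩
  · rintro (⟨x, hx, rfl⟩ | ⟨_, ⟨x, hx, rfl⟩, rfl⟩)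
    · exact Or.inl ⟨x, hx, rfl⟩
    · exact Or.inr ⟨j x, ⟨x, hx, rfl⟩, (j.map_exp x).symm⟩

/-- **`td` is invariant under injective E-field embeddings.** [folklore] -/
theorem td_map (j : ExponentialRingHom M N) (Λ Λ' : Submodule ℚ M) :
    td (Λ.map (linearOf j)) (Λ'.map (linearOf j)) = td Λ Λ' := by
  rw [td_def, td_def, gens_map, gens_map]
  exact MatroidComap.relRank_image_ringHom j.toRingHom j.toRingHom.injective _ _

end Map

section LinearMap

variable {k V W : Type*} [Field k] [AddCommGroup V] [Module k V] [AddCommGroup W] [Module k W]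

/-- **Relative linear dimension is invariant under injective linear maps.** [folklore] -/
theorem ldim_map_of_injective (f : V →ₗ[k] W) (hf : Function.Injective f) (Λ Λ' : Submodule k V) :
    ldim (Λ.map f) (Λ'.map f) = ldim Λ Λ' := by
  unfold ldim
  -- the map induced on quotients is injective
  let g : V ⧸ Λ →ₗ[k] W ⧸ Λ.map f := Λ.mapQ (Λ.map f) f (Submodule.le_comap_map f Λ)
  have hg : Function.Injective g := by
    rw [← LinearMap.ker_eq_bot, LinearMap.ker_eq_bot']
    intro z hz
    induction z using Submodule.Quotient.induction_on with
    | _ x =>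
      rw [Submodule.mapQ_apply, Submodule.Quotient.mk_eq_zero] at hz
      obtain ⟨y, hy, hxy⟩ := hz
      rw [hf hxy] at hy
      exact (Submodule.Quotient.mk_eq_zero Λ).2 hy
  have hcomm : (Λ'.map f).map (Λ.map f).mkQ = (Λ'.map Λ.mkQ).map g := by
    rw [← Submodule.map_comp, ← Submodule.map_comp, Submodule.mapQ_mkQ]
  rw [hcomm]
  exact (LinearEquiv.finrank_eq (Submodule.equivMapOfInjective g hg _)).symm

/-- `IsFG` transfers along linear maps. [folklore] -/
theorem isFG_map (f : V →ₗ[k] W) {Λ Λ' : Submodule k V}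
    (h : IsFG Λ Λ') : IsFG (Λ.map f) (Λ'.map f) := by
  obtain ⟨s, hs, hle⟩ := isFG_iff_exists_finset.1 h
  classical
  refine isFG_iff_exists_finset.2 ⟨s.image f, ?_, ?_⟩
  · intro y hy
    obtain ⟨x, hx, rfl⟩ := Finset.mem_image.1 (Finset.mem_coe.1 hy)
    exact Submodule.mem_map_of_mem (hs (Finset.mem_coe.2 hx))
  · calc Λ'.map f ≤ (Λ ⊔ Submodule.span k (s : Set V)).map f := Submodule.map_mono hle
      _ = Λ.map f ⊔ Submodule.span k ((s.image f : Finset W) : Set W) := by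
        rw [Submodule.map_sup, Submodule.map_span, Finset.coe_image]

end LinearMap

section Predim

variable {M N : Type*} [Field M] [CharZero M] [ExponentialRing M] [Field N] [CharZero N]
  [ExponentialRing N]

/-- **The predimension is invariant under injective E-field embeddings**:
`δ(j Λ'/ j Λ) = δ(Λ'/Λ)`. [cite: BaysKirby2018ANT, Def. 4.1] -/
theorem predim_map (j : ExponentialRingHom M N) (Λ Λ' : Submodule ℚ M) :
    predim (Λ.map (linearOf j)) (Λ'.map (linearOf j)) = predim Λ Λ' := by
  rw [predim_def, predim_def, td_map, ldim_map_of_injective _ (linearOf_injective j)]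

end Predim

end Literature.NumberTheory.Transcendental.GammaField

namespace Literature.ModelTheory.Quasiminimal

namespace Setup

open FirstOrder FirstOrder.Language
open Literature.NumberTheory.Transcendental Literature.NumberTheory.Transcendental.GammaField

variable {L : Language.{0, 0}} {M : Type} [L.Structure M] [Field M] [ExponentialRing M]
  {cl : Set M → Set M} (S : Setup L M cl)

/-- The chart embeddings as E-ring morphisms. [folklore] -/
abbrev ofExp (W : Finset ℝ) : ExponentialRingHom M S.F := ExpDirectLimit.ofExp S.hom W

/-- Unfolding `ofExp`. [folklore] -/
@[simp] theorem ofExp_apply (W : Finset ℝ) (m : M) : S.ofExp W m = S.of W m := rfl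

/-- Every finite subset of `F` comes from one chart. [folklore] -/
theorem exists_chart_finset (s : Finset S.F) :
    ∃ (W : Finset ℝ) (t : Finset M), (s : Set S.F) = S.of W '' ↑t := by
  classical
  choose Z m hm using fun a : S.F => ExpDirectLimit.exists_of S.hom a
  refine ⟨s.sup Z, s.image fun a => S.Ψ (Z a) (s.sup Z) (m a), ?_⟩
  ext y
  simp only [Finset.coe_image, mem_image, Finset.mem_coe]
  constructor
  · intro hy
    refine ⟨_, ⟨y, hy, rfl⟩, ?_⟩
    rw [← S.coe_hom (Finset.le_sup hy), ExpDirectLimit.of_φ S.hom (Finset.le_sup hy), hm]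
  · rintro ⟨_, ⟨a, ha, rfl⟩, rfl⟩
    rw [← S.coe_hom (Finset.le_sup ha), ExpDirectLimit.of_φ S.hom (Finset.le_sup ha), hm]
    exact ha

variable {K : Type} [Field K] (ιM : K →+* M)
  (hfix : ∀ σ : M → M, IsQFEmbOn L σ Set.univ → ∀ k, σ (ιM k) = ιM k)

include hfix in
/-- The base inside `F`, read in any chart. [folklore] -/
theorem span_base_eq_map [CharZero M] (W : Finset ℝ) (D : Set K) :
    Submodule.span ℚ (S.ιF ιM '' D) =
      (Submodule.span ℚ (ιM '' D)).map (linearOf (S.ofExp W)) := by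
  rw [Submodule.map_span]
  congr 1
  rw [image_image]
  refine image_congr fun x _ => ?_
  rw [linearOf_apply, ofExp_apply, S.of_ιM ιM hfix W x]

include hfix in
/-- **Strongness of the base transfers to the continuum model** (Bays–Kirby 2018 axiom 3 for
`F`): if the `ℚ`-span of the base is strong in the chart `M` (`δ(x̄/F_base) ≥ 0` for all finite
tuples of `M`), it is strong in `F`, because every finitely generated extension of the base in
`F` lies in one chart and `δ` is invariant under the chart embedding.
[cite: BaysKirby2018ANT, Thm 8.2 (proof)] -/
theorem isStrong_F [CharZero M] {D : Set K} (hD : IsStrong (Submodule.span ℚ (ιM '' D))) :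
    IsStrong (Submodule.span ℚ (S.ιF ιM '' D)) := by
  intro Λ' hle hfg
  obtain ⟨s, hs, hΛ'⟩ := isFG_iff_exists_finset.1 hfg
  have hΛ'eq : Λ' = Submodule.span ℚ (S.ιF ιM '' D) ⊔ Submodule.span ℚ (s : Set S.F) :=
    le_antisymm hΛ' (sup_le hle (Submodule.span_le.2 hs))
  obtain ⟨W, t, hst⟩ := S.exists_chart_finset s
  -- read everything in the chart `W`
  set j := linearOf (S.ofExp W) with hj
  have hspan : Submodule.span ℚ (s : Set S.F) = (Submodule.span ℚ (t : Set M)).map j := by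
    rw [Submodule.map_span, hst]; rfl
  rw [hΛ'eq, S.span_base_eq_map ιM hfix W D, hspan, ← Submodule.map_sup, predim_map]
  exact hD le_sup_left ((isFG_sup_left).2 (isFG_span_finset _ t))

end Setup

end Literature.ModelTheory.Quasiminimal

end
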